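import Summits.QuantumFields.YangMills.Theorems.FluctuationComparisonRegPrIntLS2BetaChartReadCurvedOfBondSmall
import Summits.QuantumFields.YangMills.Theorems.FluctuationComparisonRegPrIntLS2BetaCoarseCurlRowsRem
import HarnessLib

/-!
# S2β · (β-3)′ ∕ rows v2 — «R-DISCHARGE»: M-1‴'s free remainder letter `R` (✓p835604 `rows_LL_tower_of_remainder_K5`'s `hR`) DISCHARGED from (β-3)′ C₅ in LOCAL currency, and
# ROWS v2 with the order-2 source EXPLICIT — per coarse plaquette `(y′; μ, ν)`: sizes `M` and oscillations `O` of the datum about free direction data `Aref` on the four corner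
# blocks, `PlaqSmall δ` and bond-smallness `β` of the background: `R = 8B(O + 2κM)²∕(a − M)² + 32B(O + 2κM)M∕a² + (ℓM)³ + 8·(67ℓ·((d−1)·2L·δ))·M²∕a²`, `κ = (d·2L)·β`

Cell `ym3-torus` (YM ladder rung R3 = continuum `SU(2)` Yang–Mills on the three-torus at fixed lattice data — a RUNG: NOT d = 4, NOT infinite volume, NOT a mass gap,
NOT Clay).  Width seat `ym3-torus-px13` (gen 28); crux `stmt-QuantumFields-20520`, LINE g18-1 S2β, pairing lane; (SCT″-c)₁ = (K5′)+(BKG)+(RSP-Σ)+(β-3)′.  ✓p835604 M-1‴ typed the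
(K5) rows with a FREE per-plaquette order-2 remainder letter `R`; ✓p836340 G4-i (px10 g26) passes `R` through to the source assembler; (β-3)′ is kernel end to end by C₁–C₅
(✓p835473, ✓p835572, ✓p835880, ✓p836196, ✓p836326).  THIS FILE closes the seam: `hR` is INHABITED from C₅ with LOCAL letters only — on the bonds issuing from the four corner blocks
`y′, y′+e_μ, y′+e_ν, y′+e_μ+e_ν`: `‖X b‖ ≤ M`, `‖X b − Aref(b.dir)‖ ≤ O` (free reference data per plaquette, `‖Aref‖ ≤ M`; the consumer takes `Aref κ := X(b_κ)` at reference bonds so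
that OSC-LIFT ✓p835228 prices `O`) — via the COMPLETED corner truncation `X̃ = X` on the corner blocks, `Aref∘dir` elsewhere ((D1-loc) ✓`chartRead_apply_local`,
✓`fderiv_chartRead_apply_local`: the four bonds of `∂(y′; μ, ν)` read only corner blocks), and then the rows v2 are STATED WITH THE EXPLICIT SOURCE.
`--kind proof --supports stmt-QuantumFields-20520 --as helper`, count-neutral, DEFINITION-FREE (0 `def`, 0 `instance`, 0 `notation`, 0 `sorry`, default heartbeats); generic `P : Params`
(`r + 1 ≤ m + K`), `SU(N)`.

WHAT IS PROVED (sorry-free; `ℓ = (d+2)L`, `B = 54ℓ(e^a − 1)`, `κ = (d·2L)·β`).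
§1 ★★★`norm_remainder_le_on_four` — one background, one coarse plaquette: on each of the FOUR bonds `c` of `∂(y; μ, ν)`,
   `‖↑(ψ_{U₀}(X)c) − ↑((Dψ_{U₀}(0)X)c)‖ ≤ 8B(O + 2κM)²∕(a − M)² + 32B(O + 2κM)M∕a² + (ℓM)³ + 8·(67ℓ·((d−1)·2L·δ))·M²∕a²` (hyps: loop guard, `4α ≤ ρ ≤ innerRadius`, `PlaqSmall δ U₀`,
   `100ℓ·((d−1)·2L·δ) ≤ ρ`, `∀ b, dist1 (U₀ b) ≤ β`, `j + 2 ≤ m + K`; window `0 < a`, `100ℓ(e^a − 1) ≤ ρ`, `8M ≤ a`, `8(O + 2κM) ≤ a`; LOCAL `hXM`, `hXO`, `‖Aref‖ ≤ M`, `0 ≤ O`).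
§2 ★★★`hR_of_plaqSmall_bondSmall` — THE TOWER EDITION = M-1‴'s hypothesis `hR` VERBATIM with `R := fun i x => [§1's formula at (O i x, M i x, δ_i, β_i)]`, letters indexed by the coarse
   level as in M-1‴ (`α_{i+1}`, `δ_{i+1}`, `β_{i+1}`, `M (i+1) y′`, `O (i+1) y′`, `Aref i y′`), ONE window radius `a`.
§3 ★★★**`rows_K5_of_plaqSmall_bondSmall`** — ROWS v2 DISCHARGED: ✓p835604 `rows_LL_tower_of_remainder_K5` ∘ §2 = px16's (K5) ∕ ✓`weighted_readMax_sq_le_sources` ∕ ✓p835103 `rows_rescale` row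
   binders VERBATIM for `ρ i x = ‖Y_{U i}(∂q_x)[X̂ i]‖`, with
   `src i x = L·L·2δ_i(3L+2)·M + 48α_i·L·M + (2α^p_i + 24α_i)·ℓ·M + 4·404·ℓ·α_i·M + 4·R i x + 2δ_i·L²·M` (`M = M i x`), `R` EXPLICIT as above — no remainder letter, no gauge object, no
   additive `q·M²`: every order-2 term carries an oscillation `O`, a bond size `β`, a plaquette size `δ`, or is cubic.
§4 (v2, appended) ★★★**`rows_K5_of_plaqSmall_bondSmall_osc`** — the PAIRWISE-OSCILLATION edition: `Aref i y′ κ := X i ⟨emb y′, κ⟩` chosen inside (lit ✓`Site.blockOf_emb`), so §3's letters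
   `Aref`∕`hAM`∕`hXO` become ONE letter `hOSC : ‖X i b − X i b′‖ ≤ O (i+1) y′` for same-direction bonds issuing from the four corner blocks (OSC-LIFT ✓p835228's output shape); conclusion §3's.
§5 (v3, appended; RULING «SRC-VOL» (R-f) GO 23:34:57Z) ★`R_mono` — «R-MONO»: `λ_R` is monotone in `(O, M, δ, β)` on `0 ≤ O`, `0 ≤ M < a`, `0 ≤ δ`, `0 ≤ β`, so a SUP-currency consumer
   (READ-MAX tally, (R-e) `hSRC_read`) replaces the per-site letters by read-cell sups in one `exact`.
WHAT THE CONSUMER SUPPLIES (G4-i ✓p836340 ∕ the (SRC) assembler): the classes `α_i, α^p_i, δ_i` (θ), `β_i` (σ_t∕L), the sizes `M`, the oscillations `O` (OSC-LIFT ✓p835228 with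
`Aref κ = X(b_κ)`), the window radius `a` and the windows `8M ≤ a`, `8(O + 2κM) ≤ a`, `100ℓ(e^a − 1) ≤ ρ`, `100ℓ·((d−1)·2L·δ_i) ≤ ρ` (RULING «FB-σ»: `s₀, α₀` chosen last).

HONEST.  Composition of landed files (C₅, M-1‴, (D1-loc)); nothing of Bałaban's analysis is asserted or proved ([Balaban1985Averaging] Prop. 1∕3∕4 and [Balaban1987RG1] (0.3)–(0.4) are the
printed loci the rows transcribe); budgets, (E5), G4-i's (T)∕(SRC), (ST‴), (SCT″-c)₁₂₃, LOC‴, GAP♯∘ (`stub_uniformFibreGapOrbit`, registry 3732b7df UNTOUCHED, 0∕5), the five REGISTERED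
stubs, S2β, crux 20520, 19936, 19200, `YM3TorusSU2` — NOT proved; no summit statement is proved by a helper; rung R3 = SU(2) YM₃ on T³ at fixed lattice data — NOT d = 4, NOT infinite
volume, NOT a mass gap, NOT Clay; the Yang–Mills mass gap is NOT proved.  Axioms standard.

References: [Balaban1985Averaging] T. Bałaban, CMP **98** (1985) 17–51, p.19, (19)–(20) p.21, pp.24–25, Prop. 1 (51) p.26, Prop. 3 (121)–(126) p.36, Prop. 4 (128)–(135) pp.37–38,
(148)–(149) p.40; [Balaban1987RG1] CMP **109** (1987) 249–301, (0.1)–(0.4), (0.8), (0.18) pp.251–255.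
-/

set_option autoImplicit false

noncomputable section

open scoped Matrix.Norms.L2Operator Topology
open Filter Set Function Metric

namespace Summit.QuantumFields.YangMills.Theorems.FluctuationComparisonRegPrIntLS2BetaCoarseCurlRemainderOfPlaqSmall

open Literature.MathematicalPhysics.QuantumFieldTheory.Balaban1983to89
open Literature.MathematicalPhysics.QuantumFieldTheory.Balaban1983to89.HaarExponentialChart
open Literature.MathematicalPhysics.QuantumFieldTheory.Balaban1983to89.HaarExponentialChart.IsChartRep
open Literature.MathematicalPhysics.QuantumFieldTheory.Balaban1983to89.BlockAveraging (Small Idx avgFun loopHol off corr)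
open Literature.MathematicalPhysics.QuantumFieldTheory.Balaban1983to89.ExpMeanLog (eml expMeanLogSU deltaSU deltaSU_pos)
open Literature.MathematicalPhysics.QuantumFieldTheory.Balaban1983to89.Node00
open Literature.MathematicalPhysics.QuantumFieldTheory.Balaban1983to89.T4Continuum (walk holAt LStep loopWord Letter)
open Literature.MathematicalPhysics.QuantumFieldTheory.Balaban1983to89.BlockAveragingEMLProp2 (shift_shift_comm)
open Literature.MathematicalPhysics.QuantumFieldTheory.Balaban1983to89.BlockAveragingEMLLinearisedBackground (covWalkSum)
open Literature.MathematicalPhysics.QuantumFieldTheory.Balaban1983to89.B10Eq47AxialChi (shiftN)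
open Summit.QuantumFields.YangMills.BalabanUVNodes.N09ChartReadAveragingSmooth
open Summit.QuantumFields.YangMills.Theorems.FluctuationComparisonRegPrIntLS2BetaChartReadCplxExtension (innerRadius_le_deltaSU innerRadius_le_third)
open Summit.QuantumFields.YangMills.Theorems.FluctuationComparisonRegPrIntLS2BetaChartReadDerivLocal (chartRead_apply_local fderiv_chartRead_apply_local)
open Summit.QuantumFields.YangMills.Theorems.FluctuationComparisonRegPrIntLS2BetaChartReadCurvedOfBondSmall (norm_chartRead_sub_fderiv_le_of_plaqSmall_bondSmall)

variable {P : Params} {j : ℕ} {N : ℕ} [NeZero N]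

/-! ## §1 One coarse plaquette: the remainder letter on the four bonds of `∂(y; μ, ν)` from local sizes and oscillations -/

section OnePlaquette

/-- ★★★ **R-DISCHARGE, ONE PLAQUETTE.**  Background `U₀` at level `j` (`j + 2 ≤ m + K`): loop guard `∀ c i, dist1 (loopHol U₀ c i) ≤ α`, `4α ≤ ρ ≤ innerRadius`, `0 < ρ`;
`PlaqSmall δ U₀` with `100ℓ·((d−1)·2L·δ) ≤ ρ`; bonds within `β` of `1`.  Datum `X`, coarse plaquette `(y; μ, ν)`, free direction data `Aref : Fin d → 𝔰𝔲(N)`; LOCAL letters on the bonds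
issuing from the four corner blocks `y, y+e_μ, y+e_ν, y+e_μ+e_ν`: `‖X b‖ ≤ M`, `‖X b − Aref(b.dir)‖ ≤ O`, with `‖Aref‖ ≤ M`, `0 ≤ O`; window `0 < a`, `100ℓ(e^a − 1) ≤ ρ`, `8M ≤ a`,
`8(O + 2κM) ≤ a`, `κ = (d·2L)·β`.  Then on each of the FOUR bonds `c` of `∂(y; μ, ν)`:
`‖↑(ψ_{U₀}(X)c) − ↑((Dψ_{U₀}(0)X)c)‖ ≤ 8B(O + 2κM)²∕(a − M)² + 32B(O + 2κM)M∕a² + (ℓM)³ + 8·(67ℓ·((d−1)·2L·δ))·M²∕a²` (C₅ at the corner truncation `X̃ = X` on the corner blocks,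
`Aref∘dir` elsewhere; (D1-loc) locality of `ψ(·)c` and `Dψ(0)(·)c`). [cite: Balaban1985Averaging, p.19, pp.24-25, Prop. 3 (121)-(125) p.36, Prop. 4 (148)-(149) p.40; Balaban1987RG1, (0.3)-(0.4) pp.252-253] -/
theorem norm_remainder_le_on_four (hj2 : j + 2 ≤ P.m + P.K) (U₀ : GaugeField P j (SU N)) {α ρ : ℝ} (hρ0 : 0 < ρ)
    (hρ : ρ ≤ innerRadius (specialUnitaryLogChart (Fin N))) (hα : ∀ c i, dist1 (loopHol U₀ c i) ≤ α) (hα4 : 4 * α ≤ ρ)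
    {δ : ℝ} (hδ : 0 ≤ δ) (hU : PlaqSmall δ U₀) (hκℓ : 100 * ((((P.d + 2) * P.L : ℕ) : ℝ) * (((P.d - 1 : ℕ) : ℝ) * ((2 * P.L : ℕ) : ℝ) * δ)) ≤ ρ)
    {β : ℝ} (hβ0 : 0 ≤ β) (hβ : ∀ b : PBond P j, dist1 (U₀ b) ≤ β)
    {a : ℝ} (ha0 : 0 < a) (ha : 100 * ((((P.d + 2) * P.L : ℕ) : ℝ) * (Real.exp a - 1)) ≤ ρ)
    (X : PBond P j → (specialUnitaryLogChart (Fin N)).lie) (y : Site P (j + 1)) {μ ν : Fin P.d} (Aref : Fin P.d → (specialUnitaryLogChart (Fin N)).lie) {M O : ℝ} (hO0 : 0 ≤ O)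
    (hAM : ‖Aref‖ ≤ M) (hMa : 8 * M ≤ a) (hOa : 8 * (O + 2 * (((P.d * (2 * P.L) : ℕ) : ℝ) * β) * M) ≤ a)
    (hXM : ∀ b : PBond P j, (blockOf b.src = y ∨ blockOf b.src = y.shift μ ∨ blockOf b.src = y.shift ν ∨ blockOf b.src = (y.shift μ).shift ν) → ‖X b‖ ≤ M)
    (hXO : ∀ b : PBond P j, (blockOf b.src = y ∨ blockOf b.src = y.shift μ ∨ blockOf b.src = y.shift ν ∨ blockOf b.src = (y.shift μ).shift ν) → ‖X b - Aref b.dir‖ ≤ O)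
    (c : PBond P (j + 1)) (hc : (c = ⟨y, μ⟩ ∨ c = ⟨y.shift μ, ν⟩ ∨ c = ⟨y.shift ν, μ⟩ ∨ c = ⟨y, ν⟩)) :
    ‖(((isChartRep_specialUnitaryGroup (n := Fin N)).logChart (avgFun (expMeanLogSU (n := Fin N)) (fun b => (isChartRep_specialUnitaryGroup (n := Fin N)).expChart (X b) * U₀ b) c * (avgFun (expMeanLogSU (n := Fin N)) U₀ c)⁻¹) : (specialUnitaryLogChart (Fin N)).lie) : Matrix (Fin N) (Fin N) ℂ) -
        (((fderiv ℝ (fun (A : PBond P j → (specialUnitaryLogChart (Fin N)).lie) (c : PBond P (j + 1)) => (isChartRep_specialUnitaryGroup (n := Fin N)).logChart (avgFun (expMeanLogSU (n := Fin N)) (fun b => (isChartRep_specialUnitaryGroup (n := Fin N)).expChart (A b) * U₀ b) c * (avgFun (expMeanLogSU (n := Fin N)) U₀ c)⁻¹)) 0 X) c : (specialUnitaryLogChart (Fin N)).lie) : Matrix (Fin N) (Fin N) ℂ)‖ ≤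
      8 * (54 * ((((P.d + 2) * P.L : ℕ) : ℝ) * (Real.exp a - 1))) * (O + 2 * (((P.d * (2 * P.L) : ℕ) : ℝ) * β) * M) ^ 2 / (a - M) ^ 2 +
        32 * (54 * ((((P.d + 2) * P.L : ℕ) : ℝ) * (Real.exp a - 1))) * (O + 2 * (((P.d * (2 * P.L) : ℕ) : ℝ) * β) * M) * M / a ^ 2 +
        ((((P.d + 2) * P.L : ℕ) : ℝ) * M) ^ 3 + 8 * (67 * ((((P.d + 2) * P.L : ℕ) : ℝ) * (((P.d - 1 : ℕ) : ℝ) * ((2 * P.L : ℕ) : ℝ) * δ))) * M ^ 2 / a ^ 2 := by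
  classical
  have hj : j + 1 ≤ P.m + P.K := by omega
  have hM0 : 0 ≤ M := (norm_nonneg _).trans hAM
  have hK0 : 0 ≤ (((P.d * (2 * P.L) : ℕ) : ℝ) * β) := by positivity
  -- the corner truncation, completed by the reference field outside
  set Xt : PBond P j → (specialUnitaryLogChart (Fin N)).lie := fun b => if (blockOf b.src = y ∨ blockOf b.src = y.shift μ ∨ blockOf b.src = y.shift ν ∨ blockOf b.src = (y.shift μ).shift ν) then X b else Aref b.dir with hXt
  have hagree : ∀ b : PBond P j, (blockOf b.src = y ∨ blockOf b.src = y.shift μ ∨ blockOf b.src = y.shift ν ∨ blockOf b.src = (y.shift μ).shift ν) → X b = Xt b := fun b hb => by simp only [hXt, hb, if_true]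
  have hαδ : α < deltaSU (Fin N) := by linarith [hρ.trans (innerRadius_le_deltaSU (N := N)), deltaSU_pos (n := Fin N)]
  have hsmall : ∀ c', Small (expMeanLogSU (n := Fin N)) U₀ c' := fun c' i => lt_of_le_of_lt (hα c' i) hαδ
  -- the four bonds read only corner blocks
  have hfour : ∀ b : PBond P j, (blockOf b.src = c.src ∨ blockOf b.src = c.tgt) → X b = Xt b := by
    rcases hc with rfl | rfl | rfl | rfl <;> intro b hb
    · exact hagree b (by rcases hb with hb | hb; exact Or.inl hb; exact Or.inr (Or.inl hb))
    · exact hagree b (by rcases hb with hb | hb; exact Or.inr (Or.inl hb); exact Or.inr (Or.inr (Or.inr hb)))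
    · exact hagree b (by
        rcases hb with hb | hb
        · exact Or.inr (Or.inr (Or.inl hb))
        · refine Or.inr (Or.inr (Or.inr ?_)); rw [hb]; exact (shift_shift_comm y μ ν).symm)
    · exact hagree b (by rcases hb with hb | hb; exact Or.inl hb; exact Or.inr (Or.inr (Or.inl hb)))
  rw [chartRead_apply_local hj U₀ c hfour, fderiv_chartRead_apply_local hj U₀ hsmall c hfour]
  -- sizes of the completed truncation
  have hXtM : ‖Xt‖ ≤ M := by
    refine (pi_norm_le_iff_of_nonneg hM0).2 fun b => ?_
    by_cases hb : (blockOf b.src = y ∨ blockOf b.src = y.shift μ ∨ blockOf b.src = y.shift ν ∨ blockOf b.src = (y.shift μ).shift ν)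
    · simp only [hXt, hb, if_true]; exact hXM b hb
    · simp only [hXt, hb, if_false]; exact (norm_le_pi_norm Aref b.dir).trans hAM
  have hXtO : ‖Xt - (fun b => Aref b.dir)‖ ≤ O := by
    refine (pi_norm_le_iff_of_nonneg hO0).2 fun b => ?_
    rw [Pi.sub_apply]
    by_cases hb : (blockOf b.src = y ∨ blockOf b.src = y.shift μ ∨ blockOf b.src = y.shift ν ∨ blockOf b.src = (y.shift μ).shift ν)
    · simp only [hXt, hb, if_true]; exact hXO b hb
    · simp only [hXt, hb, if_false, sub_self, norm_zero]; exact hO0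
  have hXa : ‖Xt‖ ≤ a := by linarith
  have hXpoly : 100 * ((((P.d + 2) * P.L : ℕ) : ℝ) * (Real.exp ‖Xt‖ - 1)) ≤ ρ := by
    have hmono : Real.exp ‖Xt‖ - 1 ≤ Real.exp a - 1 := by linarith [Real.exp_le_exp.2 hXa]
    exact le_trans (by gcongr) ha
  have hosc : ‖Xt - (fun b => Aref b.dir)‖ + 2 * (((P.d * (2 * P.L) : ℕ) : ℝ) * β) * ‖Xt‖ ≤ O + 2 * (((P.d * (2 * P.L) : ℕ) : ℝ) * β) * M := by
    have := mul_le_mul_of_nonneg_left hXtM (by positivity : (0 : ℝ) ≤ 2 * (((P.d * (2 * P.L) : ℕ) : ℝ) * β))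
    linarith
  have hXA : 8 * (‖Xt - (fun b => Aref b.dir)‖ + 2 * (((P.d * (2 * P.L) : ℕ) : ℝ) * β) * ‖Xt‖) ≤ a := by linarith
  have hC := norm_chartRead_sub_fderiv_le_of_plaqSmall_bondSmall hj2 U₀ hρ0 hρ hα hα4 hδ hU hκℓ hβ0 hβ c ha0 ha Aref (by linarith) Xt hXpoly hXA
  refine hC.trans ?_
  -- monotonicity in the oscillation, the reference size and the datum size
  have hB0 : 0 ≤ 54 * ((((P.d + 2) * P.L : ℕ) : ℝ) * (Real.exp a - 1)) := by
    have : 0 ≤ Real.exp a - 1 := by linarith [Real.add_one_le_exp a]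
    positivity
  have hosc0 : 0 ≤ ‖Xt - (fun b => Aref b.dir)‖ + 2 * (((P.d * (2 * P.L) : ℕ) : ℝ) * β) * ‖Xt‖ := by positivity
  have hMa' : M < a := by linarith
  have h1 := FluctuationComparisonRegPrIntLS2BetaChartReadOscSplit.cauchy_bound_mono (a := a) (nu := ‖Aref‖) (nu' := M) hB0 hosc0 hosc hAM hMa'
  have h2 : 32 * (54 * ((((P.d + 2) * P.L : ℕ) : ℝ) * (Real.exp a - 1))) * (‖Xt - (fun b => Aref b.dir)‖ + 2 * (((P.d * (2 * P.L) : ℕ) : ℝ) * β) * ‖Xt‖) * ‖Aref‖ / a ^ 2 ≤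
      32 * (54 * ((((P.d + 2) * P.L : ℕ) : ℝ) * (Real.exp a - 1))) * (O + 2 * (((P.d * (2 * P.L) : ℕ) : ℝ) * β) * M) * M / a ^ 2 := by
    refine div_le_div_of_nonneg_right ?_ (pow_pos ha0 2).le
    exact mul_le_mul (mul_le_mul_of_nonneg_left hosc (by positivity)) hAM (norm_nonneg _) (by positivity)
  have h3 : ((((P.d + 2) * P.L : ℕ) : ℝ) * ‖Aref‖) ^ 3 ≤ ((((P.d + 2) * P.L : ℕ) : ℝ) * M) ^ 3 :=
    pow_le_pow_left₀ (by positivity) (mul_le_mul_of_nonneg_left hAM (Nat.cast_nonneg _)) 3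
  have h4 : 8 * (67 * ((((P.d + 2) * P.L : ℕ) : ℝ) * (((P.d - 1 : ℕ) : ℝ) * ((2 * P.L : ℕ) : ℝ) * δ))) * ‖Xt‖ ^ 2 / a ^ 2 ≤
      8 * (67 * ((((P.d + 2) * P.L : ℕ) : ℝ) * (((P.d - 1 : ℕ) : ℝ) * ((2 * P.L : ℕ) : ℝ) * δ))) * M ^ 2 / a ^ 2 :=
    div_le_div_of_nonneg_right (mul_le_mul_of_nonneg_left (pow_le_pow_left₀ (norm_nonneg _) hXtM 2) (by positivity)) (pow_pos ha0 2).le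
  linarith

end OnePlaquette

/-! ## §2 ★★★ The tower edition: M-1‴'s letter `hR` VERBATIM, with `R i x` the explicit (β-3)′ formula -/

section Tower

/-- ★★★ **R-DISCHARGE, TOWER EDITION — ✓p835604 `rows_LL_tower_of_remainder(_K5)`'s hypothesis `hR` INHABITED** with
`R i x := 8B(O i x + 2κ_i·M i x)²∕(a − M i x)² + 32B(O i x + 2κ_i·M i x)·M i x∕a² + (ℓ·M i x)³ + 8·(67ℓ·((d−1)·2L·δ_i))·(M i x)²∕a²`, `κ_i = (d·2L)·β_i`, `B = 54ℓ(e^a − 1)`,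
for a tower of backgrounds `U i` (levels `i < r`, `r + 1 ≤ m + K`) with per-step letters INDEXED BY THE COARSE LEVEL `i+1` as in M-1‴: loop guards `α_{i+1}` (`4α_{i+1} ≤ ρ ≤` inner radius),
`PlaqSmall δ_{i+1} (U i)` with `100ℓ·((d−1)·2L·δ_{i+1}) ≤ ρ`, bond smallness `dist1 (U i b) ≤ β_{i+1}`, local sizes `M (i+1) y′ ≥ ‖X i b‖` and oscillations `O (i+1) y′ ≥ ‖X i b − Aref i y′ (b.dir)‖` on
the four corner blocks, free reference data `Aref i y′` with `‖Aref i y′‖ ≤ M (i+1) y′`, and ONE window radius `a` (`100ℓ(e^a − 1) ≤ ρ`, `8M ≤ a`, `8(O + 2κM) ≤ a`).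
[cite: Balaban1985Averaging, p.19, pp.24-25, Prop. 3 (121)-(125) p.36, Prop. 4 (128)-(135) pp.37-38, (148)-(149) p.40; Balaban1987RG1, (0.3)-(0.4) pp.252-253] -/
theorem hR_of_plaqSmall_bondSmall {μ ν : Fin P.d} (r : ℕ) (hr2 : r + 1 ≤ P.m + P.K)
    (U : (i : ℕ) → GaugeField P i (SU N)) (X : (i : ℕ) → PBond P i → (specialUnitaryLogChart (Fin N)).lie)
    {ρ : ℝ} (hρ0 : 0 < ρ) (hρ : ρ ≤ innerRadius (specialUnitaryLogChart (Fin N)))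
    (α δ β : ℕ → ℝ)
    (hα : ∀ i, i < r → ∀ (c : PBond P (i + 1)) (ι : Idx P), dist1 (loopHol (U i) c ι) ≤ α (i + 1))
    (hα4 : ∀ i, i < r → 4 * α (i + 1) ≤ ρ)
    (hδ : ∀ i, i < r → 0 ≤ δ (i + 1)) (hUs : ∀ i, i < r → PlaqSmall (δ (i + 1)) (U i))
    (hδℓ : ∀ i, i < r → 100 * ((((P.d + 2) * P.L : ℕ) : ℝ) * (((P.d - 1 : ℕ) : ℝ) * ((2 * P.L : ℕ) : ℝ) * δ (i + 1))) ≤ ρ)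
    (hβ0 : ∀ i, i < r → 0 ≤ β (i + 1)) (hβ : ∀ i, i < r → ∀ b : PBond P i, dist1 (U i b) ≤ β (i + 1))
    {a : ℝ} (ha0 : 0 < a) (ha : 100 * ((((P.d + 2) * P.L : ℕ) : ℝ) * (Real.exp a - 1)) ≤ ρ)
    (M O : (i : ℕ) → Site P i → ℝ) (Aref : (i : ℕ) → Site P (i + 1) → Fin P.d → (specialUnitaryLogChart (Fin N)).lie)
    (hO0 : ∀ i, i < r → ∀ y' : Site P (i + 1), 0 ≤ O (i + 1) y')
    (hAM : ∀ i, i < r → ∀ y' : Site P (i + 1), ‖Aref i y'‖ ≤ M (i + 1) y')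
    (hMa : ∀ i, i < r → ∀ y' : Site P (i + 1), 8 * M (i + 1) y' ≤ a)
    (hOa : ∀ i, i < r → ∀ y' : Site P (i + 1), 8 * (O (i + 1) y' + 2 * ((((P.d * (2 * P.L) : ℕ) : ℝ) * β (i + 1))) * M (i + 1) y') ≤ a)
    (hXM : ∀ i, i < r → ∀ (y' : Site P (i + 1)) (b : PBond P i), (blockOf b.src = y' ∨ blockOf b.src = y'.shift μ ∨ blockOf b.src = y'.shift ν ∨ blockOf b.src = (y'.shift μ).shift ν) → ‖X i b‖ ≤ M (i + 1) y')
    (hXO : ∀ i, i < r → ∀ (y' : Site P (i + 1)) (b : PBond P i), (blockOf b.src = y' ∨ blockOf b.src = y'.shift μ ∨ blockOf b.src = y'.shift ν ∨ blockOf b.src = (y'.shift μ).shift ν) → ‖X i b - Aref i y' b.dir‖ ≤ O (i + 1) y') :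
    ∀ i, i < r → ∀ (y' : Site P (i + 1)) (c : PBond P (i + 1)), (c = ⟨y', μ⟩ ∨ c = ⟨y'.shift μ, ν⟩ ∨ c = ⟨y'.shift ν, μ⟩ ∨ c = ⟨y', ν⟩) →
      ‖(((isChartRep_specialUnitaryGroup (n := Fin N)).logChart (avgFun (expMeanLogSU (n := Fin N)) (fun b => (isChartRep_specialUnitaryGroup (n := Fin N)).expChart (X i b) * U i b) c * (avgFun (expMeanLogSU (n := Fin N)) (U i) c)⁻¹) : (specialUnitaryLogChart (Fin N)).lie) : Matrix (Fin N) (Fin N) ℂ) -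
        ((fderiv ℝ (fun (A : PBond P i → (specialUnitaryLogChart (Fin N)).lie) (c : PBond P (i + 1)) => (isChartRep_specialUnitaryGroup (n := Fin N)).logChart (avgFun (expMeanLogSU (n := Fin N)) (fun b => (isChartRep_specialUnitaryGroup (n := Fin N)).expChart (A b) * U i b) c * (avgFun (expMeanLogSU (n := Fin N)) (U i) c)⁻¹)) 0 (X i) c : (specialUnitaryLogChart (Fin N)).lie) : Matrix (Fin N) (Fin N) ℂ)‖ ≤
      (fun (i : ℕ) (x : Site P i) => 8 * (54 * ((((P.d + 2) * P.L : ℕ) : ℝ) * (Real.exp a - 1))) * (O i x + 2 * (((P.d * (2 * P.L) : ℕ) : ℝ) * β i) * M i x) ^ 2 / (a - M i x) ^ 2 +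
        32 * (54 * ((((P.d + 2) * P.L : ℕ) : ℝ) * (Real.exp a - 1))) * (O i x + 2 * (((P.d * (2 * P.L) : ℕ) : ℝ) * β i) * M i x) * M i x / a ^ 2 +
        ((((P.d + 2) * P.L : ℕ) : ℝ) * M i x) ^ 3 + 8 * (67 * ((((P.d + 2) * P.L : ℕ) : ℝ) * (((P.d - 1 : ℕ) : ℝ) * ((2 * P.L : ℕ) : ℝ) * δ i))) * M i x ^ 2 / a ^ 2) (i + 1) y' := by
  intro i hi y' c hc
  exact norm_remainder_le_on_four (by omega) (U i) hρ0 hρ (hα i hi) (hα4 i hi) (hδ i hi) (hUs i hi) (hδℓ i hi) (hβ0 i hi) (hβ i hi) ha0 ha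
    (X i) y' (Aref i y') (hO0 i hi y') (hAM i hi y') (hMa i hi y') (hOa i hi y') (hXM i hi y') (hXO i hi y') c hc

end Tower

/-! ## §3 ★★★ ROWS v2, DISCHARGED: the (K5) rows with the EXPLICIT (β-3)′ source — no remainder letter left -/

section RowsV2

/-- ★★★ **ROWS v2 WITH THE ORDER-2 SOURCE DISCHARGED**: ✓p835604 `rows_LL_tower_of_remainder_K5` ∘ §2 — px16's (K5) ∕ ✓`weighted_readMax_sq_le_sources` ∕ ✓p835103 `rows_rescale` row binders
VERBATIM for `ρ i x = ‖Y_{U i}(∂q_x)[X̂ i]‖` with the source `src i x = lin(M i x) + 4·R i x + 2δ_i·L²·M i x` and `R` the EXPLICIT (β-3)′ formula of §2 (oscillation × amplitude, amplitude² × (δ, β), cubic;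
NO additive `q·M²`, NO remainder letter, NO gauge object).  Hypotheses = M-1‴'s + §2's. [cite: Balaban1985Averaging, Prop. 1 (51) p.26, Prop. 3 (121)-(126) p.36, Prop. 4 (128)-(135) pp.37-38, (148)-(149) p.40; Balaban1987RG1, (0.3)-(0.4), (0.8), (0.18) pp.252-255] -/
theorem rows_K5_of_plaqSmall_bondSmall {μ ν : Fin P.d} (hμν : μ ≠ ν) (r : ℕ) (hr2 : r + 1 ≤ P.m + P.K)
    (U : (i : ℕ) → GaugeField P i (SU N)) (X : (i : ℕ) → PBond P i → (specialUnitaryLogChart (Fin N)).lie)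
    (hU : ∀ i, i < r → U (i + 1) = avgFun (expMeanLogSU (n := Fin N)) (U i))
    (hX : ∀ i, i < r → X (i + 1) = fun c : PBond P (i + 1) => (isChartRep_specialUnitaryGroup (n := Fin N)).logChart
        (avgFun (expMeanLogSU (n := Fin N)) (fun b => (isChartRep_specialUnitaryGroup (n := Fin N)).expChart (X i b) * U i b) c *
          (avgFun (expMeanLogSU (n := Fin N)) (U i) c)⁻¹))
    (α δ αp : ℕ → ℝ)
    (hα : ∀ i, i < r → ∀ (c : PBond P (i + 1)) (ι : Idx P), dist1 (loopHol (U i) c ι) ≤ α (i + 1))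
    (hα24 : ∀ i, i < r → α (i + 1) ≤ 1 / 24) (hαδ : ∀ i, i < r → α (i + 1) < deltaSU (Fin N))
    (hδ : ∀ i, i < r → 0 ≤ δ (i + 1)) (hUs : ∀ i, i < r → PlaqSmall (δ (i + 1)) (U i))
    (hαp : ∀ i, i < r → ∀ y' : Site P (i + 1),
      dist1 (holAt (avgFun (expMeanLogSU (n := Fin N)) (U i)) (walk y' [((μ, true) : Letter P.d), (ν, true), (μ, false), (ν, false)])) ≤ αp (i + 1))
    (M : (i : ℕ) → Site P i → ℝ) (hM : ∀ i, i < r → ∀ y' : Site P (i + 1), 0 ≤ M (i + 1) y')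
    (hXM : ∀ i, i < r → ∀ (y' : Site P (i + 1)) (b : PBond P i),
      (blockOf b.src = y' ∨ blockOf b.src = y'.shift μ ∨ blockOf b.src = y'.shift ν ∨ blockOf b.src = (y'.shift μ).shift ν) → ‖X i b‖ ≤ M (i + 1) y')
    {ρr : ℝ} (hρ0 : 0 < ρr) (hρr : ρr ≤ innerRadius (specialUnitaryLogChart (Fin N))) (hα4 : ∀ i, i < r → 4 * α (i + 1) ≤ ρr)
    (hδℓ : ∀ i, i < r → 100 * ((((P.d + 2) * P.L : ℕ) : ℝ) * (((P.d - 1 : ℕ) : ℝ) * ((2 * P.L : ℕ) : ℝ) * δ (i + 1))) ≤ ρr)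
    (β : ℕ → ℝ) (hβ0 : ∀ i, i < r → 0 ≤ β (i + 1)) (hβ : ∀ i, i < r → ∀ b : PBond P i, dist1 (U i b) ≤ β (i + 1))
    {a : ℝ} (ha0 : 0 < a) (ha : 100 * ((((P.d + 2) * P.L : ℕ) : ℝ) * (Real.exp a - 1)) ≤ ρr)
    (O : (i : ℕ) → Site P i → ℝ) (Aref : (i : ℕ) → Site P (i + 1) → Fin P.d → (specialUnitaryLogChart (Fin N)).lie)
    (hO0 : ∀ i, i < r → ∀ y' : Site P (i + 1), 0 ≤ O (i + 1) y')
    (hAM : ∀ i, i < r → ∀ y' : Site P (i + 1), ‖Aref i y'‖ ≤ M (i + 1) y')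
    (hMa : ∀ i, i < r → ∀ y' : Site P (i + 1), 8 * M (i + 1) y' ≤ a)
    (hOa : ∀ i, i < r → ∀ y' : Site P (i + 1), 8 * (O (i + 1) y' + 2 * ((((P.d * (2 * P.L) : ℕ) : ℝ) * β (i + 1))) * M (i + 1) y') ≤ a)
    (hXO : ∀ i, i < r → ∀ (y' : Site P (i + 1)) (b : PBond P i), (blockOf b.src = y' ∨ blockOf b.src = y'.shift μ ∨ blockOf b.src = y'.shift ν ∨ blockOf b.src = (y'.shift μ).shift ν) → ‖X i b - Aref i y' b.dir‖ ≤ O (i + 1) y')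
    (ρ src : (i : ℕ) → Site P i → ℝ)
    (hρ : ρ = fun i x => ‖covWalkSum (U i) (fun b => ((X i b : (specialUnitaryLogChart (Fin N)).lie) : Matrix (Fin N) (Fin N) ℂ))
      (walk x [((μ, true) : Letter P.d), (ν, true), (μ, false), (ν, false)])‖)
    (hsrc : src = fun i x => (P.L : ℝ) * ((P.L : ℝ) * (2 * δ i * ((P.L : ℝ) + 2 * P.L + 2) * M i x)) + 48 * α i * ((P.L : ℝ) * M i x) +
            (2 * αp i * ((((P.d + 2) * P.L : ℕ) : ℝ) * M i x) + 24 * α i * ((((P.d + 2) * P.L : ℕ) : ℝ) * M i x)) +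
            4 * (404 * (((P.d + 2) * P.L : ℕ) : ℝ) * α i * M i x) + 4 * (8 * (54 * ((((P.d + 2) * P.L : ℕ) : ℝ) * (Real.exp a - 1))) * (O i x + 2 * (((P.d * (2 * P.L) : ℕ) : ℝ) * β i) * M i x) ^ 2 / (a - M i x) ^ 2 +
        32 * (54 * ((((P.d + 2) * P.L : ℕ) : ℝ) * (Real.exp a - 1))) * (O i x + 2 * (((P.d * (2 * P.L) : ℕ) : ℝ) * β i) * M i x) * M i x / a ^ 2 +
        ((((P.d + 2) * P.L : ℕ) : ℝ) * M i x) ^ 3 + 8 * (67 * ((((P.d + 2) * P.L : ℕ) : ℝ) * (((P.d - 1 : ℕ) : ℝ) * ((2 * P.L : ℕ) : ℝ) * δ i))) * M i x ^ 2 / a ^ 2) +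
            2 * δ i * ((P.L : ℝ) ^ 2 * M i x)) :
    ∀ i, i < r → ∀ y' : Site P (i + 1),
      ρ (i + 1) y' ≤ (Fintype.card (Idx P) : ℝ)⁻¹ *
          ∑ a ∈ (Finset.univ : Finset (Idx P)) ×ˢ (Finset.range P.L ×ˢ Finset.range P.L), ρ i (shiftN (shiftN (Site.blockSite y' a.1.1) μ a.2.1) ν a.2.2) +
        src (i + 1) y' := by
  have hr : r ≤ P.m + P.K := by omega
  exact FluctuationComparisonRegPrIntLS2BetaCoarseCurlRowsRem.rows_LL_tower_of_remainder_K5 hμν r hr U X hU hX α δ αp hα hα24 hαδ hδ hUs hαp M hM hXM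
    (fun (i : ℕ) (x : Site P i) => (8 * (54 * ((((P.d + 2) * P.L : ℕ) : ℝ) * (Real.exp a - 1))) * (O i x + 2 * (((P.d * (2 * P.L) : ℕ) : ℝ) * β i) * M i x) ^ 2 / (a - M i x) ^ 2 +
        32 * (54 * ((((P.d + 2) * P.L : ℕ) : ℝ) * (Real.exp a - 1))) * (O i x + 2 * (((P.d * (2 * P.L) : ℕ) : ℝ) * β i) * M i x) * M i x / a ^ 2 +
        ((((P.d + 2) * P.L : ℕ) : ℝ) * M i x) ^ 3 + 8 * (67 * ((((P.d + 2) * P.L : ℕ) : ℝ) * (((P.d - 1 : ℕ) : ℝ) * ((2 * P.L : ℕ) : ℝ) * δ i))) * M i x ^ 2 / a ^ 2))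
    (hR_of_plaqSmall_bondSmall r hr2 U X hρ0 hρr α δ β hα hα4 hδ hUs hδℓ hβ0 hβ ha0 ha M O Aref hO0 hAM hMa hOa hXM hXO) ρ src hρ hsrc

end RowsV2

/-! ## §4 ★★★ The pairwise-oscillation edition: `O` bounds `‖X b − X b′‖` over same-direction bonds of the four corner blocks (OSC-LIFT's output shape) -/

section RowsOsc

/-- ★★★ **ROWS v2 FROM THE PAIRWISE OSCILLATION** — §3 with the reference data CHOSEN (`Aref i y′ κ := X i ⟨emb y′, κ⟩`, the datum on the bonds issuing from the block centre, lit
✓`Site.blockOf_emb`): the letters `Aref`, `hAM`, `hXO` of §3 are replaced by ONE pairwise-oscillation letter `hOSC : ‖X i b − X i b′‖ ≤ O (i+1) y′` for same-direction bonds `b, b′` issuing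
from the four corner blocks — the output shape of OSC-LIFT ✓p835228 (`osc_lift_le`).  Conclusion VERBATIM §3's (K5) rows with the explicit source. [cite: Balaban1985Averaging, Prop. 3 (121)-(126) p.36, Prop. 4 (128)-(135) pp.37-38; Balaban1987RG1, (0.3)-(0.4), (0.18) pp.252-255] -/
theorem rows_K5_of_plaqSmall_bondSmall_osc {μ ν : Fin P.d} (hμν : μ ≠ ν) (r : ℕ) (hr2 : r + 1 ≤ P.m + P.K)
    (U : (i : ℕ) → GaugeField P i (SU N)) (X : (i : ℕ) → PBond P i → (specialUnitaryLogChart (Fin N)).lie)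
    (hU : ∀ i, i < r → U (i + 1) = avgFun (expMeanLogSU (n := Fin N)) (U i))
    (hX : ∀ i, i < r → X (i + 1) = fun c : PBond P (i + 1) => (isChartRep_specialUnitaryGroup (n := Fin N)).logChart
        (avgFun (expMeanLogSU (n := Fin N)) (fun b => (isChartRep_specialUnitaryGroup (n := Fin N)).expChart (X i b) * U i b) c *
          (avgFun (expMeanLogSU (n := Fin N)) (U i) c)⁻¹))
    (α δ αp : ℕ → ℝ)
    (hα : ∀ i, i < r → ∀ (c : PBond P (i + 1)) (ι : Idx P), dist1 (loopHol (U i) c ι) ≤ α (i + 1))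
    (hα24 : ∀ i, i < r → α (i + 1) ≤ 1 / 24) (hαδ : ∀ i, i < r → α (i + 1) < deltaSU (Fin N))
    (hδ : ∀ i, i < r → 0 ≤ δ (i + 1)) (hUs : ∀ i, i < r → PlaqSmall (δ (i + 1)) (U i))
    (hαp : ∀ i, i < r → ∀ y' : Site P (i + 1),
      dist1 (holAt (avgFun (expMeanLogSU (n := Fin N)) (U i)) (walk y' [((μ, true) : Letter P.d), (ν, true), (μ, false), (ν, false)])) ≤ αp (i + 1))
    (M : (i : ℕ) → Site P i → ℝ) (hM : ∀ i, i < r → ∀ y' : Site P (i + 1), 0 ≤ M (i + 1) y')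
    (hXM : ∀ i, i < r → ∀ (y' : Site P (i + 1)) (b : PBond P i),
      (blockOf b.src = y' ∨ blockOf b.src = y'.shift μ ∨ blockOf b.src = y'.shift ν ∨ blockOf b.src = (y'.shift μ).shift ν) → ‖X i b‖ ≤ M (i + 1) y')
    {ρr : ℝ} (hρ0 : 0 < ρr) (hρr : ρr ≤ innerRadius (specialUnitaryLogChart (Fin N))) (hα4 : ∀ i, i < r → 4 * α (i + 1) ≤ ρr)
    (hδℓ : ∀ i, i < r → 100 * ((((P.d + 2) * P.L : ℕ) : ℝ) * (((P.d - 1 : ℕ) : ℝ) * ((2 * P.L : ℕ) : ℝ) * δ (i + 1))) ≤ ρr)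
    (β : ℕ → ℝ) (hβ0 : ∀ i, i < r → 0 ≤ β (i + 1)) (hβ : ∀ i, i < r → ∀ b : PBond P i, dist1 (U i b) ≤ β (i + 1))
    {a : ℝ} (ha0 : 0 < a) (ha : 100 * ((((P.d + 2) * P.L : ℕ) : ℝ) * (Real.exp a - 1)) ≤ ρr)
    (O : (i : ℕ) → Site P i → ℝ)
    (hO0 : ∀ i, i < r → ∀ y' : Site P (i + 1), 0 ≤ O (i + 1) y')
    (hMa : ∀ i, i < r → ∀ y' : Site P (i + 1), 8 * M (i + 1) y' ≤ a)
    (hOa : ∀ i, i < r → ∀ y' : Site P (i + 1), 8 * (O (i + 1) y' + 2 * ((((P.d * (2 * P.L) : ℕ) : ℝ) * β (i + 1))) * M (i + 1) y') ≤ a)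
    (hOSC : ∀ i, i < r → ∀ (y' : Site P (i + 1)) (b b' : PBond P i), (blockOf b.src = y' ∨ blockOf b.src = y'.shift μ ∨ blockOf b.src = y'.shift ν ∨ blockOf b.src = (y'.shift μ).shift ν) →
      (blockOf b'.src = y' ∨ blockOf b'.src = y'.shift μ ∨ blockOf b'.src = y'.shift ν ∨ blockOf b'.src = (y'.shift μ).shift ν) → b.dir = b'.dir → ‖X i b - X i b'‖ ≤ O (i + 1) y')
    (ρ src : (i : ℕ) → Site P i → ℝ)
    (hρ : ρ = fun i x => ‖covWalkSum (U i) (fun b => ((X i b : (specialUnitaryLogChart (Fin N)).lie) : Matrix (Fin N) (Fin N) ℂ))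
      (walk x [((μ, true) : Letter P.d), (ν, true), (μ, false), (ν, false)])‖)
    (hsrc : src = fun i x => (P.L : ℝ) * ((P.L : ℝ) * (2 * δ i * ((P.L : ℝ) + 2 * P.L + 2) * M i x)) + 48 * α i * ((P.L : ℝ) * M i x) +
            (2 * αp i * ((((P.d + 2) * P.L : ℕ) : ℝ) * M i x) + 24 * α i * ((((P.d + 2) * P.L : ℕ) : ℝ) * M i x)) +
            4 * (404 * (((P.d + 2) * P.L : ℕ) : ℝ) * α i * M i x) + 4 * (8 * (54 * ((((P.d + 2) * P.L : ℕ) : ℝ) * (Real.exp a - 1))) * (O i x + 2 * (((P.d * (2 * P.L) : ℕ) : ℝ) * β i) * M i x) ^ 2 / (a - M i x) ^ 2 +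
        32 * (54 * ((((P.d + 2) * P.L : ℕ) : ℝ) * (Real.exp a - 1))) * (O i x + 2 * (((P.d * (2 * P.L) : ℕ) : ℝ) * β i) * M i x) * M i x / a ^ 2 +
        ((((P.d + 2) * P.L : ℕ) : ℝ) * M i x) ^ 3 + 8 * (67 * ((((P.d + 2) * P.L : ℕ) : ℝ) * (((P.d - 1 : ℕ) : ℝ) * ((2 * P.L : ℕ) : ℝ) * δ i))) * M i x ^ 2 / a ^ 2) +
            2 * δ i * ((P.L : ℝ) ^ 2 * M i x)) :
    ∀ i, i < r → ∀ y' : Site P (i + 1),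
      ρ (i + 1) y' ≤ (Fintype.card (Idx P) : ℝ)⁻¹ *
          ∑ a ∈ (Finset.univ : Finset (Idx P)) ×ˢ (Finset.range P.L ×ˢ Finset.range P.L), ρ i (shiftN (shiftN (Site.blockSite y' a.1.1) μ a.2.1) ν a.2.2) +
        src (i + 1) y' := by
  -- reference data: the datum at the bonds issuing from the block centre `emb y′`
  refine rows_K5_of_plaqSmall_bondSmall hμν r hr2 U X hU hX α δ αp hα hα24 hαδ hδ hUs hαp M hM hXM hρ0 hρr hα4 hδℓ β hβ0 hβ ha0 ha O
    (fun i y' κ => X i ⟨emb y', κ⟩) hO0 (fun i hi y' => ?_) hMa hOa (fun i hi y' b hb => ?_) ρ src hρ hsrc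
  · refine (pi_norm_le_iff_of_nonneg (hM i hi y')).2 fun κ => hXM i hi y' ⟨emb y', κ⟩ (Or.inl ?_)
    exact Site.blockOf_emb (by omega) y'
  · exact hOSC i hi y' b ⟨emb y', b.dir⟩ hb (Or.inl (Site.blockOf_emb (by omega) y')) rfl

end RowsOsc

/-! ## §5 ★ «R-MONO» (RULING «SRC-VOL» (R-f)): the explicit remainder is MONOTONE in the oscillation, the size, the plaquette class and the bond class -/

section Mono

omit [NeZero N] in
/-- ★ **«R-MONO»**: `λ_R(O, M, δ, β) ≤ λ_R(O′, M′, δ′, β′)` whenever `0 ≤ O ≤ O′`, `0 ≤ M ≤ M′ < a`, `0 ≤ δ ≤ δ′`, `0 ≤ β ≤ β′` (`0 < a`) — so any SUP-currency consumer replaces the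
per-site letters of §1–§4 by read-cell sups in one `exact` (RULING «SRC-VOL» (R-e)∕(R-f): sources are priced as read-max `S′`-shares). [folklore] -/
theorem R_mono {a O O' M M' δ δ' β β' : ℝ} (ha0 : 0 < a) (hO0 : 0 ≤ O) (hOO : O ≤ O') (hM0 : 0 ≤ M) (hMM : M ≤ M') (hM'a : M' < a)
    (hδ0 : 0 ≤ δ) (hδδ : δ ≤ δ') (hβ0 : 0 ≤ β) (hββ : β ≤ β') :
    8 * (54 * ((((P.d + 2) * P.L : ℕ) : ℝ) * (Real.exp a - 1))) * (O + 2 * (((P.d * (2 * P.L) : ℕ) : ℝ) * β) * M) ^ 2 / (a - M) ^ 2 +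
        32 * (54 * ((((P.d + 2) * P.L : ℕ) : ℝ) * (Real.exp a - 1))) * (O + 2 * (((P.d * (2 * P.L) : ℕ) : ℝ) * β) * M) * M / a ^ 2 +
        ((((P.d + 2) * P.L : ℕ) : ℝ) * M) ^ 3 + 8 * (67 * ((((P.d + 2) * P.L : ℕ) : ℝ) * (((P.d - 1 : ℕ) : ℝ) * ((2 * P.L : ℕ) : ℝ) * δ))) * M ^ 2 / a ^ 2 ≤
      8 * (54 * ((((P.d + 2) * P.L : ℕ) : ℝ) * (Real.exp a - 1))) * (O' + 2 * (((P.d * (2 * P.L) : ℕ) : ℝ) * β') * M') ^ 2 / (a - M') ^ 2 +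
        32 * (54 * ((((P.d + 2) * P.L : ℕ) : ℝ) * (Real.exp a - 1))) * (O' + 2 * (((P.d * (2 * P.L) : ℕ) : ℝ) * β') * M') * M' / a ^ 2 +
        ((((P.d + 2) * P.L : ℕ) : ℝ) * M') ^ 3 + 8 * (67 * ((((P.d + 2) * P.L : ℕ) : ℝ) * (((P.d - 1 : ℕ) : ℝ) * ((2 * P.L : ℕ) : ℝ) * δ'))) * M' ^ 2 / a ^ 2 := by
  have hB0 : 0 ≤ 54 * ((((P.d + 2) * P.L : ℕ) : ℝ) * (Real.exp a - 1)) := by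
    have : 0 ≤ Real.exp a - 1 := by linarith [Real.add_one_le_exp a]
    positivity
  have hK0 : 0 ≤ (((P.d * (2 * P.L) : ℕ) : ℝ) * β) := by positivity
  have hKK : (((P.d * (2 * P.L) : ℕ) : ℝ) * β) ≤ (((P.d * (2 * P.L) : ℕ) : ℝ) * β') := mul_le_mul_of_nonneg_left hββ (Nat.cast_nonneg _)
  have hM'0 : 0 ≤ M' := hM0.trans hMM
  have hO'0 : 0 ≤ O' := hO0.trans hOO
  have hκM : 2 * (((P.d * (2 * P.L) : ℕ) : ℝ) * β) * M ≤ 2 * (((P.d * (2 * P.L) : ℕ) : ℝ) * β') * M' := by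
    have := mul_le_mul hKK hMM hM0 (hK0.trans hKK)
    linarith
  have hosc0 : 0 ≤ O + 2 * (((P.d * (2 * P.L) : ℕ) : ℝ) * β) * M := by positivity
  have hosc : O + 2 * (((P.d * (2 * P.L) : ℕ) : ℝ) * β) * M ≤ O' + 2 * (((P.d * (2 * P.L) : ℕ) : ℝ) * β') * M' := by linarith
  have h1 := FluctuationComparisonRegPrIntLS2BetaChartReadOscSplit.cauchy_bound_mono (a := a) (nu := M) (nu' := M') hB0 hosc0 hosc hMM hM'a
  have h2 : 32 * (54 * ((((P.d + 2) * P.L : ℕ) : ℝ) * (Real.exp a - 1))) * (O + 2 * (((P.d * (2 * P.L) : ℕ) : ℝ) * β) * M) * M / a ^ 2 ≤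
      32 * (54 * ((((P.d + 2) * P.L : ℕ) : ℝ) * (Real.exp a - 1))) * (O' + 2 * (((P.d * (2 * P.L) : ℕ) : ℝ) * β') * M') * M' / a ^ 2 := by
    refine div_le_div_of_nonneg_right ?_ (pow_pos ha0 2).le
    have hB32 : 0 ≤ 32 * (54 * ((((P.d + 2) * P.L : ℕ) : ℝ) * (Real.exp a - 1))) := by linarith
    exact mul_le_mul (mul_le_mul_of_nonneg_left hosc hB32) hMM hM0 (mul_nonneg hB32 (hosc0.trans hosc))
  have h3 : ((((P.d + 2) * P.L : ℕ) : ℝ) * M) ^ 3 ≤ ((((P.d + 2) * P.L : ℕ) : ℝ) * M') ^ 3 :=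
    pow_le_pow_left₀ (by positivity) (mul_le_mul_of_nonneg_left hMM (Nat.cast_nonneg _)) 3
  have h4 : 8 * (67 * ((((P.d + 2) * P.L : ℕ) : ℝ) * (((P.d - 1 : ℕ) : ℝ) * ((2 * P.L : ℕ) : ℝ) * δ))) * M ^ 2 / a ^ 2 ≤
      8 * (67 * ((((P.d + 2) * P.L : ℕ) : ℝ) * (((P.d - 1 : ℕ) : ℝ) * ((2 * P.L : ℕ) : ℝ) * δ'))) * M' ^ 2 / a ^ 2 := by
    refine div_le_div_of_nonneg_right ?_ (pow_pos ha0 2).le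
    have hδ'0 : 0 ≤ δ' := hδ0.trans hδδ
    have hδc : 8 * (67 * ((((P.d + 2) * P.L : ℕ) : ℝ) * (((P.d - 1 : ℕ) : ℝ) * ((2 * P.L : ℕ) : ℝ) * δ))) ≤ 8 * (67 * ((((P.d + 2) * P.L : ℕ) : ℝ) * (((P.d - 1 : ℕ) : ℝ) * ((2 * P.L : ℕ) : ℝ) * δ'))) := by
      gcongr
    exact mul_le_mul hδc (pow_le_pow_left₀ hM0 hMM 2) (by positivity) (by positivity)
  linarith

end Mono

end Summit.QuantumFields.YangMills.Theorems.FluctuationComparisonRegPrIntLS2BetaCoarseCurlRemainderOfPlaqSmall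

end
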